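import Summits.Ventures.CertifiedManyBodySolver.Certificates.HubbardSquare_n7o8_obsOP1E_TLB0gbD2_box1chord_A0
import Summits.Ventures.CertifiedManyBodySolver.Certificates.HubbardSquare_n7o8_boxword_cuprate_3d_v0
import HarnessLib
import HarnessLib.Audit

/-!
# Ventures/CertifiedManyBodySolver — Certificates/HubbardSquare_n7o8_obsOP1E_TLB0gbD2_box1corners.lean

HONEST FRAMING: first certified bounds on pairing observables; positivity-scale pair-LRO CEILINGS (a ceiling never speaks to
the PRESENCE of order; × ≈ 55–80 above print); not informative vs print; not a superconductivity verdict; no phase sentence.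
CANDIDATE (hubbard-obs RULING (ii) d279: item «BOX1-OP1E-CORNERS», nobody's registry row today). Zero compute inside Lean, no
`sorry`, no new axiom; nothing is asserted unconditionally. Cell hubbard-algo (D-0042 crew (5)), seat hubbard-box-eng-3
(`prover-hubbard-box-eng-3-g7-0`).

«BOX1-OP1E-CORNERS» — THE TRANSPORT-FREE BOX EDITION OF THE ONE-POINT PAIR-LRO CEILING. §1–§2 of this file are the GENERIC
device (every `(t′, U)`, every literal): (§1) the OP1-E one-point ROW SHAPE `OP1ERowAtU tp U c κ u μ` at a general coupling `U`
(the `U = 8` shape `OP1ERowAt` of `…_segmix_A0A0p` is the special case) and its Koma–Tasaki reading `OP1ERowAtU.ceilingAt`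
(row + cap ⇒ `ObsPairLROCeilingAt tp U (7/8) c′`); (§2) the **FOUR-ANCHOR MIX** `OP1ERowAtU.ceilingAt_mix4`: rows at four anchors
`θ_v = (tp_v, U_v)` with nonnegative weights `w_v` whose `κ`-weighted first moments CANCEL the two pencil directions of the affine map
`(t′, U) ↦ H_L(1, t′, U)` (`Σ w_v κ_v (tp − tp_v) = 0`, `Σ w_v κ_v (U_v − U) = 0`, `Σ w_v κ_v = 1`) give, for EVERY unit `ζ`, a row AT
`θ = (tp, U)` (pure algebra: `TTPrimeFree.re_expect_tt_affine`), hence the leaf at `θ` under a cap `e(1,tp,U;7/8) ≤ T` with constant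
`((Σ w_v (c_v + κ_v u_v) − T)/Σ w_v)²` — this is the T4′ box-dual combination of per-vertex SDP duals (pub/hubbard-algo/hubbard-box-eng-3
BOXDUAL-FORMAT §20) in closed form for a program whose only `θ`-dependent datum is the energy-window row. On a box cell the TENSOR
weights divided by `κ_v` cancel both directions at once (barycentric identities), so no transport / drift cost is paid: at an affine cap
through the corner caps the bound at `θ` is a weighted MEAN of the corner bounds. §3 specialises the device to the n = 7/8 face of box #1,
`(t′, U) ∈ [−3/10, −1/5] × [15/2, 17/2]`, under the box-#1 cap PYRAMID of hubbard-box-eng-1's `BoxWordCuprate3d.boxCuprate3d_plane_of`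
(#445 + #257 docc window × (U − 8) + FS-1 `−HOP2` window × (t′ + 1/4); CONVEX piecewise-affine, hence below the tensor interpolant of its
corner values, `box1CapPyramid_le_bilinear`): `box1Face_pairLROCeilingAt_of_cornerRows` — four corner rows with GENERIC literals ⇒
`ObsPairLROCeilingAt t′ U (7/8) c′` at every point of the face for every `c′ ≥ m²`, `m` = the largest corner constant (the face word EQUALS the
worst corner; no drift cost). The sibling file `…_box1corners_face.lean` instantiates it with the four BOX1-OP1E-CORNERS claim nodes
(hubbard-box-eng-3 g7 kit j286557 / j286558 / j286561 / j286563 + D₂ node-grade transplants).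
WHAT THIS IS NOT: a registry row or MOVE (the pen's); a phase word; informative vs print; a statement at `n ≠ 7/8`.
References: T. Koma, H. Tasaki, J. Stat. Phys. 76 (1994) 745, Theorem 5 [KomaTasaki1994]; R. B. Israel, *Convexity in the Theory of
Lattice Gases* (1979) Thm I.3.4 [Israel1979]; H. Xu et al., Science 384 (2024) eadh7691, eq. (1) [XuEtAl2024].
-/

noncomputable section

namespace Summit.Ventures.CertifiedManyBodySolver.Certificates

open Matrix Complex Finset Literature.MathematicalPhysics.QuantumLattice Literature.Probability.LatticeModels
open Literature.MathematicalPhysics.QuantumLattice.HubbardWave0 ThermodynamicLimit Filter Topology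
open Literature.MathematicalPhysics.QuantumManyBody.StateRelaxation
open Summit.Ventures.CertifiedManyBodySolver.Observables
open Summit.Ventures.CertifiedManyBodySolver.Transport
open scoped ComplexOrder ComplexConjugate BigOperators

/-! ### §1 The OP1-E one-point row shape at a general coupling `(t′, U)` -/

/-- **The OP1-E one-point ROW at `(t, t′, U) = (1, tp, U)` with literals `(c, κ, u, μ)`** (B0-class program: window
`op1eWindow_TLB0gbD2`, group `op1eD2_TLB0gbD2`, objective `−Φ₀`, `ν = 7/16`): for every torus side `L ≥ 3` on which the window projects
injectively and every UNIT vector `ζ`,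
`c + Σ_σ μ_σ (Re⟨ζ,N_σζ⟩/L² − 7/16) + κ (u − Re⟨ζ,H_L(1,tp,U)ζ⟩/L²) ≤ Re ω̄_ζ(Γ(ι_L)(−Γ(incl)Φ₀))` — the `U`-generic form of
`OP1ERowAt` (which is the case `U = 8`): the all-`ζ` Lagrangian reading of an exact obsB one-point certificate. [cite: KomaTasaki1994, Theorem 5] -/
def OP1ERowAtU (tp U c κ u : ℝ) (μ : Fin 2 → ℝ) : Prop :=
  ∀ (L : ℕ) [NeZero L]
    (hInj : Set.InjOn (Torus.proj (d := 2) L) ↑op1eWindow_TLB0gbD2)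
    (ζ : Fock (Orb (FermionTorus 2 L))), 3 ≤ L → star ζ ⬝ᵥ ζ = 1 →
    c + ∑ σ : Fin 2, μ σ *
          ((star ζ ⬝ᵥ ((∑ y : FermionTorus 2 L, numberOp y σ) *ᵥ ζ)).re / (L : ℝ) ^ 2 - (7 / 16 : ℝ)) +
      κ * (u - (star ζ ⬝ᵥ (hubbardTorusTT' L 1 tp U *ᵥ ζ)).re / (L : ℝ) ^ 2) ≤
      (orbitState (spaceGroupUnitary op1eD2_TLB0gbD2) ζ (fermionEmbed (PolySite.toTorusEmb L hInj)
        (-(fermionEmbed (PolySite.incl pairRegion_subset_op1eWindow_TLB0gbD2)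
          (localPairAt (insert (0 : Site 2) unitSteps) dWaveFormFactor 0))))).re

/-- The `U = 8` row shape of `…_segmix_A0A0p` IS the general shape at `U = 8`. [cite: KomaTasaki1994, Theorem 5] -/
theorem OP1ERowAtU.of_OP1ERowAt {tp c κ u : ℝ} {μ : Fin 2 → ℝ} (h : OP1ERowAt tp c κ u μ) : OP1ERowAtU tp 8 c κ u μ :=
  fun L _ hInj ζ hL hζ => h L hInj ζ hL hζ

/-- **Koma–Tasaki reading of ONE row at `(tp, U)`**: a row `OP1ERowAtU tp U c κ u μ` with `κ ≥ 0`, `U ≥ 0` and a CAP `e(1,tp,U;7/8) ≤ T`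
give the summit-format leaf `ObsPairLROCeilingAt tp U (7/8) c′` for every rational `c′ ≥ (c − κ(T − u))²` (hubbard-obs-p1's tower
discharger with NO auxiliary row; the filling term vanishes at `n/2 = 7/16`). A ceiling; says nothing about presence. [cite: KomaTasaki1994, Theorem 5] -/
theorem OP1ERowAtU.ceilingAt {tp U c κ u : ℝ} {μ : Fin 2 → ℝ} (h : OP1ERowAtU tp U c κ u μ) (hκ : 0 ≤ κ) (hU : 0 ≤ U)
    {T : ℝ} (hT : energyDensityTT' 1 tp U (7 / 8) ≤ T)
    {c' : ℚ} (hc' : (c - κ * (T - u)) ^ 2 ≤ ((c' : ℚ) : ℝ)) :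
    ObsPairLROCeilingAt tp U (7 / 8) c' := by
  classical
  obtain ⟨L₀, hL₀⟩ := exists_forall_le_injOn_proj (d := 2) op1eWindow_TLB0gbD2
  have hInj : ∀ L : ℕ, max L₀ 3 ≤ L → Set.InjOn (Torus.proj (d := 2) L) ↑op1eWindow_TLB0gbD2 :=
    fun L hL => hL₀ L (le_trans (le_max_left _ _) hL)
  have hc'' : (c - κ * (T - u) + (∑ σ : Fin 2, μ σ) * ((7 / 8 : ℝ) / 2 - 7 / 16)) ^ 2 ≤ ((c' : ℚ) : ℝ) := by
    have e : c - κ * (T - u) + (∑ σ : Fin 2, μ σ) * ((7 / 8 : ℝ) / 2 - 7 / 16) = c - κ * (T - u) := by ring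
    rw [e]; exact hc'
  refine ObsPairLROCeilingAt_of_onePoint_orbitState_bound_sq_aux (c := c) (A := κ * (T - u))
    (u := T) (ν := 7 / 16) hU (by norm_num) (by norm_num) μ hκ hT (ι := Fin 0)
    (fun _ => tp) (fun _ => U) (fun _ => 1) (fun _ => 0) (fun _ => 0)
    (fun _ => hU) (fun _ => one_pos) (fun _ => le_rfl) (fun _ => by simp)
    op1eD2_TLB0gbD2_nonempty b1gSign_eq_one_of_mem_op1eD2_TLB0gbD2 pairRegion_subset_op1eWindow_TLB0gbD2
    (max L₀ 3) hInj ?_ hc''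
  intro L _ hL ζ hζ
  have h3 : 3 ≤ L := le_trans (le_max_right _ _) hL
  have r := h L (hInj L hL) ζ h3 hζ
  simp only [Finset.univ_eq_empty, Finset.sum_empty, add_zero]
  convert r using 1
  ring

/-! ### §2 The four-anchor mix (T4′ box dual in closed form; every ζ) -/

/-- **FOUR-ANCHOR MIX ⇒ leaf at `θ = (tp, U)`.** Rows at `θ_v = (tp_v, U_v)` (`v = 1..4`) with literals `(c_v, κ_v, u_v, μ_v)`,
weights `w_v ≥ 0` with `Σ w_v > 0` such that `Σ_v w_v κ_v = 1`, `Σ_v w_v κ_v (tp − tp_v) = 0` and `Σ_v w_v κ_v (U_v − U) = 0`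
(the `κ`-weighted pencil moments of `H_L(1,·,·)` cancel — `TTPrimeFree.re_expect_tt_affine`), `U ≥ 0`, and a cap
`e(1,tp,U;7/8) ≤ T`: then `ObsPairLROCeilingAt tp U (7/8) c′` for every rational
`c′ ≥ ((Σ_v w_v (c_v + κ_v u_v) − T) / Σ_v w_v)²`. Proof: `Σ_v w_v·(row_v at ζ)` is, after the pencil identities and the
cancellations, `W`-times a row AT `θ` with `κ = 1/W`, reference `T` and constant `(Σ w_v(c_v + κ_v u_v) − T)/W`; then `ceilingAt`.
A ceiling; says nothing about presence. [cite: KomaTasaki1994, Theorem 5] [cite: XuEtAl2024, eq. (1)] -/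
theorem OP1ERowAtU.ceilingAt_mix4
    {tp₁ U₁ c₁ κ₁ u₁ tp₂ U₂ c₂ κ₂ u₂ tp₃ U₃ c₃ κ₃ u₃ tp₄ U₄ c₄ κ₄ u₄ : ℝ} {μ₁ μ₂ μ₃ μ₄ : Fin 2 → ℝ}
    (h₁ : OP1ERowAtU tp₁ U₁ c₁ κ₁ u₁ μ₁) (h₂ : OP1ERowAtU tp₂ U₂ c₂ κ₂ u₂ μ₂)
    (h₃ : OP1ERowAtU tp₃ U₃ c₃ κ₃ u₃ μ₃) (h₄ : OP1ERowAtU tp₄ U₄ c₄ κ₄ u₄ μ₄)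
    {tp U w₁ w₂ w₃ w₄ : ℝ} (hw₁ : 0 ≤ w₁) (hw₂ : 0 ≤ w₂) (hw₃ : 0 ≤ w₃) (hw₄ : 0 ≤ w₄)
    (hW : 0 < w₁ + w₂ + w₃ + w₄)
    (hS : w₁ * κ₁ + w₂ * κ₂ + w₃ * κ₃ + w₄ * κ₄ = 1)
    (hK : w₁ * κ₁ * (tp - tp₁) + w₂ * κ₂ * (tp - tp₂) + w₃ * κ₃ * (tp - tp₃) + w₄ * κ₄ * (tp - tp₄) = 0)
    (hD : w₁ * κ₁ * (U₁ - U) + w₂ * κ₂ * (U₂ - U) + w₃ * κ₃ * (U₃ - U) + w₄ * κ₄ * (U₄ - U) = 0)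
    (hU : 0 ≤ U) {T : ℝ} (hT : energyDensityTT' 1 tp U (7 / 8) ≤ T)
    {c' : ℚ} (hc' : ((w₁ * (c₁ + κ₁ * u₁) + w₂ * (c₂ + κ₂ * u₂) + w₃ * (c₃ + κ₃ * u₃) + w₄ * (c₄ + κ₄ * u₄) - T) /
      (w₁ + w₂ + w₃ + w₄)) ^ 2 ≤ ((c' : ℚ) : ℝ)) :
    ObsPairLROCeilingAt tp U (7 / 8) c' := by
  set W := w₁ + w₂ + w₃ + w₄ with hWdef
  -- the mixed row AT θ: constant (Σ w (c + κ u) − T)/W, κ = 1/W, reference T, μ = (Σ w μ)/W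
  have hrow : OP1ERowAtU tp U
      ((w₁ * (c₁ + κ₁ * u₁) + w₂ * (c₂ + κ₂ * u₂) + w₃ * (c₃ + κ₃ * u₃) + w₄ * (c₄ + κ₄ * u₄) - T) / W)
      (1 / W) T (fun σ => (w₁ * μ₁ σ + w₂ * μ₂ σ + w₃ * μ₃ σ + w₄ * μ₄ σ) / W) := by
    intro L _ hInj ζ hL hζ
    have r₁ := h₁ L hInj ζ hL hζ
    have r₂ := h₂ L hInj ζ hL hζ
    have r₃ := h₃ L hInj ζ hL hζ
    have r₄ := h₄ L hInj ζ hL hζ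
    -- pencil identities: every anchor energy in terms of the energy AT θ plus the two pencil directions
    have e₁ := TTPrimeFree.re_expect_tt_affine (L := L) 1 tp U tp₁ U₁ ζ
    have e₂ := TTPrimeFree.re_expect_tt_affine (L := L) 1 tp U tp₂ U₂ ζ
    have e₃ := TTPrimeFree.re_expect_tt_affine (L := L) 1 tp U tp₃ U₃ ζ
    have e₄ := TTPrimeFree.re_expect_tt_affine (L := L) 1 tp U tp₄ U₄ ζ
    simp only [Literature.MathematicalPhysics.QuantumLattice.expect] at e₁ e₂ e₃ e₄
    rw [e₁] at r₁; rw [e₂] at r₂; rw [e₃] at r₃; rw [e₄] at r₄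
    -- abbreviations (all real numbers)
    set E := (star ζ ⬝ᵥ (hubbardTorusTT' L 1 tp U *ᵥ ζ)).re with hE
    set Kd := (star ζ ⬝ᵥ (TTPrimeFree.diagHop L *ᵥ ζ)).re with hKd
    set Dd := (star ζ ⬝ᵥ ((∑ x : FermionTorus 2 L, numberOp x 0 * numberOp x 1) *ᵥ ζ)).re with hDd
    set R := (orbitState (spaceGroupUnitary op1eD2_TLB0gbD2) ζ (fermionEmbed (PolySite.toTorusEmb L hInj)
        (-(fermionEmbed (PolySite.incl pairRegion_subset_op1eWindow_TLB0gbD2)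
          (localPairAt (insert (0 : Site 2) unitSteps) dWaveFormFactor 0))))).re with hR
    simp only [Fin.sum_univ_two] at r₁ r₂ r₃ r₄ ⊢
    set N0 := (star ζ ⬝ᵥ ((∑ y : FermionTorus 2 L, numberOp y 0) *ᵥ ζ)).re with hN0
    set N1 := (star ζ ⬝ᵥ ((∑ y : FermionTorus 2 L, numberOp y 1) *ᵥ ζ)).re with hN1
    have hL2 : (0 : ℝ) < (L : ℝ) ^ 2 := by
      have : (3 : ℝ) ≤ (L : ℝ) := by exact_mod_cast hL
      positivity
    have hWne : W ≠ 0 := ne_of_gt hW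
    -- weighted sum of the four rows ≤ W·R
    have s₁ := mul_le_mul_of_nonneg_left r₁ hw₁
    have s₂ := mul_le_mul_of_nonneg_left r₂ hw₂
    have s₃ := mul_le_mul_of_nonneg_left r₃ hw₃
    have s₄ := mul_le_mul_of_nonneg_left r₄ hw₄
    -- W × (the mixed row's left-hand side)
    set LW := (w₁ * (c₁ + κ₁ * u₁) + w₂ * (c₂ + κ₂ * u₂) + w₃ * (c₃ + κ₃ * u₃) + w₄ * (c₄ + κ₄ * u₄) - T) +
        ((w₁ * μ₁ 0 + w₂ * μ₂ 0 + w₃ * μ₃ 0 + w₄ * μ₄ 0) * (N0 / (L : ℝ) ^ 2 - 7 / 16) +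
         (w₁ * μ₁ 1 + w₂ * μ₂ 1 + w₃ * μ₃ 1 + w₄ * μ₄ 1) * (N1 / (L : ℝ) ^ 2 - 7 / 16)) +
        (T - E / (L : ℝ) ^ 2) with hLW
    have hsum : LW =
        w₁ * (c₁ + (μ₁ 0 * (N0 / (L : ℝ) ^ 2 - 7 / 16) + μ₁ 1 * (N1 / (L : ℝ) ^ 2 - 7 / 16)) +
            κ₁ * (u₁ - (E + (tp - tp₁) * Kd + (U₁ - U) * Dd) / (L : ℝ) ^ 2)) +
        w₂ * (c₂ + (μ₂ 0 * (N0 / (L : ℝ) ^ 2 - 7 / 16) + μ₂ 1 * (N1 / (L : ℝ) ^ 2 - 7 / 16)) +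
            κ₂ * (u₂ - (E + (tp - tp₂) * Kd + (U₂ - U) * Dd) / (L : ℝ) ^ 2)) +
        w₃ * (c₃ + (μ₃ 0 * (N0 / (L : ℝ) ^ 2 - 7 / 16) + μ₃ 1 * (N1 / (L : ℝ) ^ 2 - 7 / 16)) +
            κ₃ * (u₃ - (E + (tp - tp₃) * Kd + (U₃ - U) * Dd) / (L : ℝ) ^ 2)) +
        w₄ * (c₄ + (μ₄ 0 * (N0 / (L : ℝ) ^ 2 - 7 / 16) + μ₄ 1 * (N1 / (L : ℝ) ^ 2 - 7 / 16)) +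
            κ₄ * (u₄ - (E + (tp - tp₄) * Kd + (U₄ - U) * Dd) / (L : ℝ) ^ 2)) := by
      rw [hLW]
      linear_combination (E / (L : ℝ) ^ 2) * hS + (Kd / (L : ℝ) ^ 2) * hK + (Dd / (L : ℝ) ^ 2) * hD
    have hLW_le : LW ≤ W * R := by
      rw [hsum, hWdef]
      linarith [s₁, s₂, s₃, s₄]
    have goal_eq : (w₁ * (c₁ + κ₁ * u₁) + w₂ * (c₂ + κ₂ * u₂) + w₃ * (c₃ + κ₃ * u₃) + w₄ * (c₄ + κ₄ * u₄) - T) / W +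
        ((w₁ * μ₁ 0 + w₂ * μ₂ 0 + w₃ * μ₃ 0 + w₄ * μ₄ 0) / W * (N0 / (L : ℝ) ^ 2 - 7 / 16) +
         (w₁ * μ₁ 1 + w₂ * μ₂ 1 + w₃ * μ₃ 1 + w₄ * μ₄ 1) / W * (N1 / (L : ℝ) ^ 2 - 7 / 16)) +
        1 / W * (T - E / (L : ℝ) ^ 2) = LW / W := by
      rw [hLW]
      field_simp
    rw [goal_eq, div_le_iff₀ hW]
    linarith [hLW_le]
  have hκ : (0 : ℝ) ≤ 1 / W := by positivity
  refine OP1ERowAtU.ceilingAt hrow hκ hU hT ?_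
  have e : (w₁ * (c₁ + κ₁ * u₁) + w₂ * (c₂ + κ₂ * u₂) + w₃ * (c₃ + κ₃ * u₃) + w₄ * (c₄ + κ₄ * u₄) - T) / W -
      1 / W * (T - T) =
      (w₁ * (c₁ + κ₁ * u₁) + w₂ * (c₂ + κ₂ * u₂) + w₃ * (c₃ + κ₃ * u₃) + w₄ * (c₄ + κ₄ * u₄) - T) / W := by ring
  rw [e]; exact hc'

/-! ### §3 The n = 7/8 face of box #1: four corner rows ⇒ the leaf at EVERY point of the face -/

/-- The CB/r257 cap PYRAMID of box #1 at `n = 7/8` (the right-hand side of box-eng-1's `boxCuprate3d_plane_of`):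
`pyr(t′, U) = u₄₄₅ + max((U−8)D_lo, (U−8)D_hi) + max((t′+1/4)τ_lo, (t′+1/4)τ_hi)` with `[D_lo, D_hi]` = CERTIFIED #257 and
`[τ_lo, τ_hi]` the FS-1 `−HOP2` window — a CONVEX piecewise-affine majorant of the concave `e(1, ·, ·; 7/8)`. [cite: Israel1979, Thm. I.3.4] -/
def box1CapPyramid (tp U : ℝ) : ℝ :=
  (-12079530027017/17592186044416 : ℝ) +
    max ((U - 8) * (38455087907569911627595/4835703278458516698824704 : ℝ))
        ((U - 8) * (456988009968292079185545/4835703278458516698824704 : ℝ)) +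
    max ((tp - (-1/4)) * (-6023622597/10000000000 : ℝ)) ((tp - (-1/4)) * (11460582111/10000000000 : ℝ))

/-- **Convexity of the cap pyramid on the face**: at every `(t′, U) ∈ [−3/10, −1/5] × [15/2, 17/2]` the pyramid lies BELOW the
bilinear (tensor) interpolant of its four corner values — each `max` of two lines through the kink is below its chord on the
interval (`D_lo ≤ D_hi`, `τ_lo ≤ τ_hi`). [cite: Israel1979, Thm. I.3.4] -/
theorem box1CapPyramid_le_bilinear {tp U : ℝ} (htp : -3/10 ≤ tp ∧ tp ≤ -1/5) (hU : 15/2 ≤ U ∧ U ≤ 17/2) :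
    box1CapPyramid tp U ≤
      10 * ((17/2 - U) * (-1/5 - tp)) * box1CapPyramid (-3/10) (15/2) +
      10 * ((17/2 - U) * (tp + 3/10)) * box1CapPyramid (-1/5) (15/2) +
      10 * ((U - 15/2) * (-1/5 - tp)) * box1CapPyramid (-3/10) (17/2) +
      10 * ((U - 15/2) * (tp + 3/10)) * box1CapPyramid (-1/5) (17/2) := by
  obtain ⟨ht1, ht2⟩ := htp
  obtain ⟨hU1, hU2⟩ := hU
  -- corner values of the two univariate pieces
  have cU1 : max (((15/2 : ℝ) - 8) * (38455087907569911627595/4835703278458516698824704 : ℝ))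
      (((15/2 : ℝ) - 8) * (456988009968292079185545/4835703278458516698824704 : ℝ)) =
      ((15/2 : ℝ) - 8) * (38455087907569911627595/4835703278458516698824704 : ℝ) :=
    max_eq_left (by norm_num)
  have cU2 : max (((17/2 : ℝ) - 8) * (38455087907569911627595/4835703278458516698824704 : ℝ))
      (((17/2 : ℝ) - 8) * (456988009968292079185545/4835703278458516698824704 : ℝ)) =
      ((17/2 : ℝ) - 8) * (456988009968292079185545/4835703278458516698824704 : ℝ) :=
    max_eq_right (by norm_num)
  have ct1 : max (((-3/10 : ℝ) - (-1/4)) * (-6023622597/10000000000 : ℝ)) (((-3/10 : ℝ) - (-1/4)) * (11460582111/10000000000 : ℝ)) =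
      ((-3/10 : ℝ) - (-1/4)) * (-6023622597/10000000000 : ℝ) := max_eq_left (by norm_num)
  have ct2 : max (((-1/5 : ℝ) - (-1/4)) * (-6023622597/10000000000 : ℝ)) (((-1/5 : ℝ) - (-1/4)) * (11460582111/10000000000 : ℝ)) =
      ((-1/5 : ℝ) - (-1/4)) * (11460582111/10000000000 : ℝ) := max_eq_right (by norm_num)
  simp only [box1CapPyramid, cU1, cU2, ct1, ct2]
  -- each max ≤ its chord; the weights are a tensor partition of unity
  have mU : max ((U - 8) * (38455087907569911627595/4835703278458516698824704 : ℝ))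
      ((U - 8) * (456988009968292079185545/4835703278458516698824704 : ℝ)) ≤
      (17/2 - U) * (((15/2 : ℝ) - 8) * (38455087907569911627595/4835703278458516698824704 : ℝ)) +
      (U - 15/2) * (((17/2 : ℝ) - 8) * (456988009968292079185545/4835703278458516698824704 : ℝ)) := by
    apply max_le <;> nlinarith
  have mt : max ((tp - (-1/4)) * (-6023622597/10000000000 : ℝ)) ((tp - (-1/4)) * (11460582111/10000000000 : ℝ)) ≤
      10 * (-1/5 - tp) * (((-3/10 : ℝ) - (-1/4)) * (-6023622597/10000000000 : ℝ)) +
      10 * (tp + 3/10) * (((-1/5 : ℝ) - (-1/4)) * (11460582111/10000000000 : ℝ)) := by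
    apply max_le <;> nlinarith
  nlinarith [mU, mt, mul_nonneg (sub_nonneg.mpr hU2) (sub_nonneg.mpr ht2), mul_nonneg (sub_nonneg.mpr hU2) (by linarith : (0:ℝ) ≤ tp + 3/10),
    mul_nonneg (sub_nonneg.mpr hU1) (sub_nonneg.mpr ht2), mul_nonneg (sub_nonneg.mpr hU1) (by linarith : (0:ℝ) ≤ tp + 3/10)]

/-- Arithmetic helper for the node dictionary `c = −M̃/√2`: `a ≤ b`, `s > 0` ⇒ `−(b/s) ≤ −a/s`. [cite: KomaTasaki1994, Theorem 5] -/
theorem neg_div_le_neg_div_of_le {a b s : ℝ} (hs : 0 < s) (hab : a ≤ b) : -(b / s) ≤ -a / s := by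
  rw [neg_div]; exact neg_le_neg (div_le_div_of_nonneg_right hab hs.le)

/-- Arithmetic helper for the node dictionary: `0 ≤ a`, `s > 0` ⇒ `−a/s ≤ 0`. [cite: KomaTasaki1994, Theorem 5] -/
theorem neg_div_nonpos_of_nonneg {a s : ℝ} (hs : 0 < s) (ha : 0 ≤ a) : -a / s ≤ 0 := by
  rw [neg_div, neg_nonpos]; exact div_nonneg ha hs.le

/-- **THE FACE THEOREM (generic literals).** Four OP1-E rows at the outer corners `(t′, U) ∈ {−3/10, −1/5} × {15/2, 17/2}` of the
n = 7/8 face of box #1 with multipliers `0 < κ_v ≤ K`, constants `−m ≤ c_v ≤ 0` and energy references `u_v` AT LEAST the cap pyramid's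
corner values, together with the pyramid's inputs BY NAME (#445 node, #257 docc window nodes, the FS-1 `−HOP2` window literal —
box-eng-1's `boxCuprate3d_plane_of`), give the summit-format leaf `ObsPairLROCeilingAt t′ U (7/8) c′` at EVERY point of the face for
every rational `c′ ≥ m²`: the four-anchor mix with the tensor weights divided by `κ_v` (both pencil directions cancel by the
barycentric identities), cap at `θ` = the tensor interpolant of the `u_v` (≥ pyramid ≥ `e`, §3 convexity), under which the mixed constant
is a weighted MEAN of the `c_v`. No transport, no drift cost. A ceiling; says nothing about presence.
[cite: KomaTasaki1994, Theorem 5] [cite: Israel1979, Thm. I.3.4] -/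
theorem box1Face_pairLROCeilingAt_of_cornerRows
    {c₁ κ₁ u₁ c₂ κ₂ u₂ c₃ κ₃ u₃ c₄ κ₄ u₄ K m : ℝ} {μ₁ μ₂ μ₃ μ₄ : Fin 2 → ℝ}
    (hSW : OP1ERowAtU (-3/10) (15/2) c₁ κ₁ u₁ μ₁) (hNW : OP1ERowAtU (-1/5) (15/2) c₂ κ₂ u₂ μ₂)
    (hSE : OP1ERowAtU (-3/10) (17/2) c₃ κ₃ u₃ μ₃) (hNE : OP1ERowAtU (-1/5) (17/2) c₄ κ₄ u₄ μ₄)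
    (hκ₁ : 0 < κ₁) (hκ₂ : 0 < κ₂) (hκ₃ : 0 < κ₃) (hκ₄ : 0 < κ₄)
    (hK₁ : κ₁ ≤ K) (hK₂ : κ₂ ≤ K) (hK₃ : κ₃ ≤ K) (hK₄ : κ₄ ≤ K)
    (hc₁ : -m ≤ c₁ ∧ c₁ ≤ 0) (hc₂ : -m ≤ c₂ ∧ c₂ ≤ 0) (hc₃ : -m ≤ c₃ ∧ c₃ ≤ 0) (hc₄ : -m ≤ c₄ ∧ c₄ ≤ 0)
    (hu₁ : box1CapPyramid (-3/10) (15/2) ≤ u₁) (hu₂ : box1CapPyramid (-1/5) (15/2) ≤ u₂)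
    (hu₃ : box1CapPyramid (-3/10) (17/2) ≤ u₃) (hu₄ : box1CapPyramid (-1/5) (17/2) ≤ u₄)
    (h445 : cert_dbt329pair_allk) (h257lo : cert_r257_lro_M3U8tpm1o4_w2_b4_kry1_kry2c3_hop2_Dlo)
    (h257up : cert_r257_lro_M3U8tpm1o4_w2_b4_kry1_kry2c3_hop2_Dup)
    (htau : ∀ (ω : InfVolFermionState 2) (Ls : ℕ → ℕ) (ψ : ∀ L, Fock (Orb (FermionTorus 2 L))),
      Tendsto Ls atTop atTop →
      (∀ j, IsGroundStateInSector (hubbardTorusTT' (Ls j) 1 (-1/4) 8) (rectN (7/8) (Ls j)) 0 (ψ (Ls j))) →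
      (∀ j, star (ψ (Ls j)) ⬝ᵥ ψ (Ls j) = 1) → ω.IsTorusLimitOf ψ Ls →
      (-6023622597/10000000000 : ℝ) ≤ ω.meanEnergy (hubbardTTPrimeFermionInteraction 0 1 0) 1 ∧
        ω.meanEnergy (hubbardTTPrimeFermionInteraction 0 1 0) 1 ≤ (11460582111/10000000000 : ℝ))
    {tp U : ℝ} (htp : -3/10 ≤ tp ∧ tp ≤ -1/5) (hU : 15/2 ≤ U ∧ U ≤ 17/2)
    {c' : ℚ} (hc' : m ^ 2 ≤ ((c' : ℚ) : ℝ)) :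
    ObsPairLROCeilingAt tp U (7 / 8) c' := by
  obtain ⟨ht1, ht2⟩ := htp
  obtain ⟨hU1, hU2⟩ := hU
  have hKpos : 0 < K := lt_of_lt_of_le hκ₁ hK₁
  have hU0 : (0:ℝ) ≤ U := by linarith
  -- the cap AT θ: pyramid ≤ tensor interpolant of the corner pyramid values ≤ tensor interpolant of the references u_v
  have hpyr : energyDensityTT' 1 tp U (7 / 8) ≤ box1CapPyramid tp U := by
    have := BoxWordCuprate3d.boxCuprate3d_plane_of h445 h257lo h257up htau tp hU0
    simpa only [box1CapPyramid] using this
  have hbil := box1CapPyramid_le_bilinear ⟨ht1, ht2⟩ ⟨hU1, hU2⟩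
  -- tensor weights of θ in the cell (a partition of unity) and the κ-scaled weights
  set a₁ := 10 * ((17/2 - U) * (-1/5 - tp)) with ha₁
  set a₂ := 10 * ((17/2 - U) * (tp + 3/10)) with ha₂
  set a₃ := 10 * ((U - 15/2) * (-1/5 - tp)) with ha₃
  set a₄ := 10 * ((U - 15/2) * (tp + 3/10)) with ha₄
  have ha₁0 : 0 ≤ a₁ := by rw [ha₁]; exact mul_nonneg (by norm_num) (mul_nonneg (by linarith) (by linarith))
  have ha₂0 : 0 ≤ a₂ := by rw [ha₂]; exact mul_nonneg (by norm_num) (mul_nonneg (by linarith) (by linarith))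
  have ha₃0 : 0 ≤ a₃ := by rw [ha₃]; exact mul_nonneg (by norm_num) (mul_nonneg (by linarith) (by linarith))
  have ha₄0 : 0 ≤ a₄ := by rw [ha₄]; exact mul_nonneg (by norm_num) (mul_nonneg (by linarith) (by linarith))
  have hsum1 : a₁ + a₂ + a₃ + a₄ = 1 := by rw [ha₁, ha₂, ha₃, ha₄]; ring
  have hT : energyDensityTT' 1 tp U (7 / 8) ≤ a₁ * u₁ + a₂ * u₂ + a₃ * u₃ + a₄ * u₄ := by
    have m₁ := mul_le_mul_of_nonneg_left hu₁ ha₁0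
    have m₂ := mul_le_mul_of_nonneg_left hu₂ ha₂0
    have m₃ := mul_le_mul_of_nonneg_left hu₃ ha₃0
    have m₄ := mul_le_mul_of_nonneg_left hu₄ ha₄0
    linarith [hpyr, hbil, m₁, m₂, m₃, m₄]
  have hw₁ : 0 ≤ a₁ / κ₁ := div_nonneg ha₁0 hκ₁.le
  have hw₂ : 0 ≤ a₂ / κ₂ := div_nonneg ha₂0 hκ₂.le
  have hw₃ : 0 ≤ a₃ / κ₃ := div_nonneg ha₃0 hκ₃.le
  have hw₄ : 0 ≤ a₄ / κ₄ := div_nonneg ha₄0 hκ₄.le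
  -- W ≥ 1/K > 0
  have hW : 0 < a₁ / κ₁ + a₂ / κ₂ + a₃ / κ₃ + a₄ / κ₄ := by
    have l₁ : a₁ / K ≤ a₁ / κ₁ := div_le_div_of_nonneg_left ha₁0 hκ₁ hK₁
    have l₂ : a₂ / K ≤ a₂ / κ₂ := div_le_div_of_nonneg_left ha₂0 hκ₂ hK₂
    have l₃ : a₃ / K ≤ a₃ / κ₃ := div_le_div_of_nonneg_left ha₃0 hκ₃ hK₃
    have l₄ : a₄ / K ≤ a₄ / κ₄ := div_le_div_of_nonneg_left ha₄0 hκ₄ hK₄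
    have e : a₁ / K + a₂ / K + a₃ / K + a₄ / K = 1 / K := by
      rw [← add_div, ← add_div, ← add_div, hsum1]
    have hk : (0:ℝ) < 1 / K := by positivity
    linarith
  have hS : a₁ / κ₁ * κ₁ + a₂ / κ₂ * κ₂ + a₃ / κ₃ * κ₃ + a₄ / κ₄ * κ₄ = 1 := by
    rw [div_mul_cancel₀ _ hκ₁.ne', div_mul_cancel₀ _ hκ₂.ne', div_mul_cancel₀ _ hκ₃.ne', div_mul_cancel₀ _ hκ₄.ne']
    exact hsum1
  have hK : a₁ / κ₁ * κ₁ * (tp - (-3/10)) + a₂ / κ₂ * κ₂ * (tp - (-1/5)) + a₃ / κ₃ * κ₃ * (tp - (-3/10)) +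
      a₄ / κ₄ * κ₄ * (tp - (-1/5)) = 0 := by
    rw [div_mul_cancel₀ _ hκ₁.ne', div_mul_cancel₀ _ hκ₂.ne', div_mul_cancel₀ _ hκ₃.ne', div_mul_cancel₀ _ hκ₄.ne',
      ha₁, ha₂, ha₃, ha₄]
    ring
  have hD : a₁ / κ₁ * κ₁ * (15/2 - U) + a₂ / κ₂ * κ₂ * (15/2 - U) + a₃ / κ₃ * κ₃ * (17/2 - U) +
      a₄ / κ₄ * κ₄ * (17/2 - U) = 0 := by
    rw [div_mul_cancel₀ _ hκ₁.ne', div_mul_cancel₀ _ hκ₂.ne', div_mul_cancel₀ _ hκ₃.ne', div_mul_cancel₀ _ hκ₄.ne',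
      ha₁, ha₂, ha₃, ha₄]
    ring
  refine OP1ERowAtU.ceilingAt_mix4 hSW hNW hSE hNE hw₁ hw₂ hw₃ hw₄ hW hS hK hD hU0 hT ?_
  -- the mixed constant is (Σ (a_v/κ_v) c_v)/W ∈ [−m, 0]: its square is ≤ m² ≤ c'
  have num : a₁ / κ₁ * (c₁ + κ₁ * u₁) + a₂ / κ₂ * (c₂ + κ₂ * u₂) + a₃ / κ₃ * (c₃ + κ₃ * u₃) + a₄ / κ₄ * (c₄ + κ₄ * u₄) -
      (a₁ * u₁ + a₂ * u₂ + a₃ * u₃ + a₄ * u₄) = a₁ / κ₁ * c₁ + a₂ / κ₂ * c₂ + a₃ / κ₃ * c₃ + a₄ / κ₄ * c₄ := by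
    have e₁ : a₁ / κ₁ * (c₁ + κ₁ * u₁) = a₁ / κ₁ * c₁ + a₁ * u₁ := by field_simp
    have e₂ : a₂ / κ₂ * (c₂ + κ₂ * u₂) = a₂ / κ₂ * c₂ + a₂ * u₂ := by field_simp
    have e₃ : a₃ / κ₃ * (c₃ + κ₃ * u₃) = a₃ / κ₃ * c₃ + a₃ * u₃ := by field_simp
    have e₄ : a₄ / κ₄ * (c₄ + κ₄ * u₄) = a₄ / κ₄ * c₄ + a₄ * u₄ := by field_simp
    rw [e₁, e₂, e₃, e₄]; ring
  rw [num]
  set W := a₁ / κ₁ + a₂ / κ₂ + a₃ / κ₃ + a₄ / κ₄ with hWdef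
  set S := a₁ / κ₁ * c₁ + a₂ / κ₂ * c₂ + a₃ / κ₃ * c₃ + a₄ / κ₄ * c₄ with hSdef
  have t₁ := mul_le_mul_of_nonneg_left hc₁.1 hw₁
  have t₂ := mul_le_mul_of_nonneg_left hc₂.1 hw₂
  have t₃ := mul_le_mul_of_nonneg_left hc₃.1 hw₃
  have t₄ := mul_le_mul_of_nonneg_left hc₄.1 hw₄
  have t₁' := mul_le_mul_of_nonneg_left hc₁.2 hw₁
  have t₂' := mul_le_mul_of_nonneg_left hc₂.2 hw₂
  have t₃' := mul_le_mul_of_nonneg_left hc₃.2 hw₃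
  have t₄' := mul_le_mul_of_nonneg_left hc₄.2 hw₄
  have eW : -m * W = a₁ / κ₁ * (-m) + a₂ / κ₂ * (-m) + a₃ / κ₃ * (-m) + a₄ / κ₄ * (-m) := by rw [hWdef]; ring
  have hSlo : -m * W ≤ S := by rw [eW, hSdef]; linarith
  have hShi : S ≤ 0 := by
    rw [hSdef]
    simp only [mul_zero] at t₁' t₂' t₃' t₄'
    linarith
  have hm0 : 0 ≤ m := by linarith [hc₁.1, hc₁.2]
  have q1 : -m ≤ S / W := by rw [le_div_iff₀ hW]; exact hSlo
  have q2 : S / W ≤ m := (div_nonpos_of_nonpos_of_nonneg hShi hW.le).trans hm0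
  exact (sq_le_sq' q1 q2).trans hc'

end Summit.Ventures.CertifiedManyBodySolver.Certificates

end
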